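import Mathlib.Topology.Algebra.InfiniteSum.Basic
import Literature.MathematicalPhysics.StatisticalMechanics.BarlowRings
import Literature.MathematicalPhysics.StatisticalMechanics.BarlowCoordination
import HarnessLib

/-!
# Route EnergyDerivativeOrder · LimitTransfer — helper I: shells of a relaxed Barlow stacking

Support lemmas for item stmt-AtomisticToContinuum-12284 (`LimitTransfer`): the distance spectrum
of a (relaxed, `h² ≠ ⅔a²` allowed) Barlow stacking `barlowStacking a h s` of a Hägg sequence `s`
near its bottom, and the value of the energy per particle of the hcp periodic configuration on
radial test functions supported below the second shell.

`twelve_mul_dist_sq` (integer form of `12·dist²`, no ideal-ratio hypothesis), `site_cases`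
(coincide / twelve first-shell neighbours at `a`, `a' = √(a²/3 + h²)` / `dist² ≥ 3a², 4a²/3 + h²`
or `4h²`), `ncard_shell` (exactly twelve other sites within `ρ` for `max a a' ≤ ρ` below the
second shell), `energyPerParticle_eq_zero_of` / `energyPerParticle_hcp_eq_six_of`. [folklore]
-/

noncomputable section

namespace Summit.AtomisticToContinuum.Crystallization.Theorems.EnergyDerivativeOrderLimitTransfer

open Literature.MathematicalPhysics.StatisticalMechanics
open Set Metric
open scoped BigOperators

variable {a h : ℝ} {s : ℤ → ℤ}

/-! ## The integer form of squared distances -/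

/-- **`12 · dist² = a² · (3(2P+Q+Λ)² + (3Q+Λ)²) + 12 K² h²`** for ANY layer spacing `h`, with
`P = i − i'`, `Q = j − j'`, `K = k − k'`, `Λ = L(k) − L(k')` (cf. the ideal-ratio form
`twelve_mul_dist_barlowPos_sq` of `BarlowCoordination.lean`). [folklore] -/
theorem twelve_mul_dist_sq (s : ℤ → ℤ) (k i j k' i' j' : ℤ) :
    12 * dist (barlowPos a h s k i j) (barlowPos a h s k' i' j') ^ 2 =
      a ^ 2 * ((3 * (2 * (i - i') + (j - j') + (haggLabel s k - haggLabel s k')) ^ 2 +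
        (3 * (j - j') + (haggLabel s k - haggLabel s k')) ^ 2 : ℤ) : ℝ) +
      12 * (((k - k') ^ 2 : ℤ) : ℝ) * h ^ 2 := by
  rw [dist_barlowPos_sq]
  have h3 : (√3 : ℝ) ^ 2 = 3 := Real.sq_sqrt (by norm_num)
  push_cast
  linear_combination
    (3 * a ^ 2 * ((j : ℝ) - j' + ((haggLabel s k : ℝ) - haggLabel s k') / 3) ^ 2) * h3

/-- The in-layer form `3(2P+Q)² + (3Q)² = 12 (P² + PQ + Q²)` vanishes, equals `12`, or is at
least `36` (the Löschian numbers skip `2`). [folklore] -/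
theorem inLayer_cases (P Q : ℤ) :
    (P = 0 ∧ Q = 0) ∨ 3 * (2 * P + Q) ^ 2 + (3 * Q) ^ 2 = 12 ∨
      36 ≤ 3 * (2 * P + Q) ^ 2 + (3 * Q) ^ 2 := by
  by_contra hcon
  push Not at hcon
  obtain ⟨hne, h12, hlt⟩ := hcon
  have hQ : Q ^ 2 < 2 ^ 2 := by nlinarith [sq_nonneg (2 * P + Q)]
  have hP : (2 * P + Q) ^ 2 < 4 ^ 2 := by nlinarith [sq_nonneg Q]
  obtain ⟨hQ1, hQ2⟩ := abs_lt_of_sq_lt_sq' hQ (by norm_num)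
  obtain ⟨hP1, hP2⟩ := abs_lt_of_sq_lt_sq' hP (by norm_num)
  have hP3 : -3 ≤ P := by omega
  have hP4 : P ≤ 3 := by omega
  interval_cases P <;> interval_cases Q <;> omega

/-! ## Classification of pairs of sites -/

/-- **Pairs of sites of a Barlow stacking of a Hägg sequence**: they coincide, or the second is
one of the twelve first-shell neighbours of the first (six in-layer offsets `sixOffsets`, three
offsets `threeOffsets (−s k)` in layer `k + 1`, three offsets `threeOffsets (s (k−1))` in layer
`k − 1`), or their squared distance is at least one of `3a²`, `4a²/3 + h²`, `4h²`. [folklore] -/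
theorem site_cases (hs : IsHaggSeq s) (k i j k' i' j' : ℤ) :
    (k, i, j) = (k', i', j') ∨
    (k' = k ∧ (i - i', j - j') ∈ sixOffsets) ∨
    (k' = k + 1 ∧ (i - i', j - j') ∈ threeOffsets (-s k)) ∨
    (k' = k - 1 ∧ (i - i', j - j') ∈ threeOffsets (s (k - 1))) ∨
    (3 * a ^ 2 ≤ dist (barlowPos a h s k i j) (barlowPos a h s k' i' j') ^ 2 ∨
      4 * a ^ 2 / 3 + h ^ 2 ≤ dist (barlowPos a h s k i j) (barlowPos a h s k' i' j') ^ 2 ∨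
      4 * h ^ 2 ≤ dist (barlowPos a h s k i j) (barlowPos a h s k' i' j') ^ 2) := by
  have h12 := twelve_mul_dist_sq (a := a) (h := h) s k i j k' i' j'
  set D : ℝ := dist (barlowPos a h s k i j) (barlowPos a h s k' i' j') with hD
  set Λ : ℤ := haggLabel s k - haggLabel s k' with hΛ
  set F : ℤ := 3 * (2 * (i - i') + (j - j') + Λ) ^ 2 + (3 * (j - j') + Λ) ^ 2 with hF
  have hF0 : (0 : ℝ) ≤ (F : ℝ) := by positivity
  have ha2 : 0 ≤ a ^ 2 := sq_nonneg a
  have hh2 : 0 ≤ h ^ 2 := sq_nonneg h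
  by_cases hK : k' = k
  · -- same layer: `Λ = 0`, the form is the in-layer form
    have hΛ0 : Λ = 0 := by rw [hΛ, hK, sub_self]
    have hK0 : (((k - k') ^ 2 : ℤ) : ℝ) = 0 := by rw [hK, sub_self]; simp
    rw [hK0, mul_zero, zero_mul, add_zero] at h12
    rcases inLayer_cases (i - i') (j - j') with ⟨hP, hQ⟩ | hF12 | h36
    · left
      rw [sub_eq_zero] at hP hQ
      rw [hK, hP, hQ]
    · right; left
      refine ⟨hK, mem_sixOffsets_iff.2 hF12⟩
    · right; right; right; right; left
      have h36' : (36 : ℝ) ≤ (F : ℝ) := by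
        have : (36 : ℤ) ≤ F := by rw [hF, hΛ0]; simpa using h36
        exact_mod_cast this
      nlinarith
  · by_cases hK1 : (k - k') ^ 2 = 1
    · -- adjacent layers
      have hK1' : (((k - k') ^ 2 : ℤ) : ℝ) = 1 := by rw [hK1]; simp
      rw [hK1', mul_one] at h12
      obtain ⟨hk1, hk2⟩ := abs_le_one_of_sq_le_one hK1.le
      rcases (show k' = k + 1 ∨ k' = k - 1 by omega) with hk' | hk'
      · have hΛ' : Λ = -s k := by rw [hΛ, hk', haggLabel_sub_haggLabel_succ]
        have hσ : -s k = 1 ∨ -s k = -1 := by rcases hs k with h1 | h1 <;> omega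
        rcases adjLayer_eq_four_or_sixteen_le (P := i - i') (Q := j - j') hσ with h4 | h16
        · right; right; left
          exact ⟨hk', (mem_threeOffsets_iff hσ).2 h4⟩
        · right; right; right; right; right; left
          have h16' : (16 : ℝ) ≤ (F : ℝ) := by
            have : (16 : ℤ) ≤ F := by rw [hF, hΛ']; exact h16
            exact_mod_cast this
          nlinarith
      · have hΛ' : Λ = s (k - 1) := by rw [hΛ, hk', haggLabel_sub_haggLabel_pred]
        have hσ : s (k - 1) = 1 ∨ s (k - 1) = -1 := hs (k - 1)
        rcases adjLayer_eq_four_or_sixteen_le (P := i - i') (Q := j - j') hσ with h4 | h16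
        · right; right; right; left
          exact ⟨hk', (mem_threeOffsets_iff hσ).2 h4⟩
        · right; right; right; right; right; left
          have h16' : (16 : ℝ) ≤ (F : ℝ) := by
            have : (16 : ℤ) ≤ F := by rw [hF, hΛ']; exact h16
            exact_mod_cast this
          nlinarith
    · -- two or more layers apart
      right; right; right; right; right; right
      have hK4 : (4 : ℤ) ≤ (k - k') ^ 2 := by
        have hne : k - k' ≠ 0 := sub_ne_zero.2 (Ne.symm hK)
        have h1 : 1 ≤ (k - k') ^ 2 := by
          have := Int.one_le_abs hne
          nlinarith [abs_nonneg (k - k'), sq_abs (k - k')]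
        by_contra hlt
        push Not at hlt
        obtain ⟨h1', h2'⟩ := abs_lt_of_sq_lt_sq' (show (k - k') ^ 2 < 2 ^ 2 by omega) (by norm_num)
        have : (k - k') ^ 2 ≤ 1 := by nlinarith
        omega
      have hK4' : (4 : ℝ) ≤ (((k - k') ^ 2 : ℤ) : ℝ) := by exact_mod_cast hK4
      nlinarith [mul_nonneg ha2 hF0, mul_le_mul_of_nonneg_right hK4' hh2]

/-- An in-layer first-shell neighbour is at squared distance `a²`. [folklore] -/
theorem dist_sq_of_mem_sixOffsets {k i j i' j' : ℤ} (hm : (i - i', j - j') ∈ sixOffsets) :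
    dist (barlowPos a h s k i j) (barlowPos a h s k i' j') ^ 2 = a ^ 2 := by
  have h12 := twelve_mul_dist_sq (a := a) (h := h) s k i j k i' j'
  have hF := mem_sixOffsets_iff.1 hm
  rw [sub_self] at h12
  have hF' : (((3 * (2 * (i - i') + (j - j') + 0) ^ 2 + (3 * (j - j') + 0) ^ 2 : ℤ)) : ℝ) = 12 := by
    have : (3 * (2 * (i - i') + (j - j') + 0) ^ 2 + (3 * (j - j') + 0) ^ 2 : ℤ) = 12 := by
      simpa using hF
    exact_mod_cast this
  rw [hF'] at h12
  have : (((k - k) ^ 2 : ℤ) : ℝ) = 0 := by simp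
  rw [this] at h12
  linarith

/-- A neighbour of the next layer is at squared distance `a²/3 + h²`. [folklore] -/
theorem dist_sq_of_mem_threeOffsets_succ (hs : IsHaggSeq s) {k i j i' j' : ℤ}
    (hm : (i - i', j - j') ∈ threeOffsets (-s k)) :
    dist (barlowPos a h s k i j) (barlowPos a h s (k + 1) i' j') ^ 2 = a ^ 2 / 3 + h ^ 2 := by
  have h12 := twelve_mul_dist_sq (a := a) (h := h) s k i j (k + 1) i' j'
  have hσ : -s k = 1 ∨ -s k = -1 := by rcases hs k with h1 | h1 <;> omega
  have hF := (mem_threeOffsets_iff hσ).1 hm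
  rw [haggLabel_sub_haggLabel_succ] at h12
  have hF' : (((3 * (2 * (i - i') + (j - j') + -s k) ^ 2 + (3 * (j - j') + -s k) ^ 2 : ℤ)) : ℝ) =
      4 := by exact_mod_cast hF
  rw [hF'] at h12
  have : (((k - (k + 1)) ^ 2 : ℤ) : ℝ) = 1 := by push_cast; ring
  rw [this] at h12
  linarith

/-- A neighbour of the previous layer is at squared distance `a²/3 + h²`. [folklore] -/
theorem dist_sq_of_mem_threeOffsets_pred (hs : IsHaggSeq s) {k i j i' j' : ℤ}
    (hm : (i - i', j - j') ∈ threeOffsets (s (k - 1))) :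
    dist (barlowPos a h s k i j) (barlowPos a h s (k - 1) i' j') ^ 2 = a ^ 2 / 3 + h ^ 2 := by
  have h12 := twelve_mul_dist_sq (a := a) (h := h) s k i j (k - 1) i' j'
  have hσ : s (k - 1) = 1 ∨ s (k - 1) = -1 := hs (k - 1)
  have hF := (mem_threeOffsets_iff hσ).1 hm
  rw [haggLabel_sub_haggLabel_pred] at h12
  have hF' : (((3 * (2 * (i - i') + (j - j') + s (k - 1)) ^ 2 +
      (3 * (j - j') + s (k - 1)) ^ 2 : ℤ)) : ℝ) = 4 := by exact_mod_cast hF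
  rw [hF'] at h12
  have : (((k - (k - 1)) ^ 2 : ℤ) : ℝ) = 1 := by push_cast; ring
  rw [this] at h12
  linarith

/-- **Squared distances of distinct sites**: `a²`, `a²/3 + h²`, or at least one of `3a²`,
`4a²/3 + h²`, `4h²`. [folklore] -/
theorem dist_sq_cases (hs : IsHaggSeq s) {k i j k' i' j' : ℤ} (hne : (k, i, j) ≠ (k', i', j')) :
    dist (barlowPos a h s k i j) (barlowPos a h s k' i' j') ^ 2 = a ^ 2 ∨
    dist (barlowPos a h s k i j) (barlowPos a h s k' i' j') ^ 2 = a ^ 2 / 3 + h ^ 2 ∨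
    (3 * a ^ 2 ≤ dist (barlowPos a h s k i j) (barlowPos a h s k' i' j') ^ 2 ∨
      4 * a ^ 2 / 3 + h ^ 2 ≤ dist (barlowPos a h s k i j) (barlowPos a h s k' i' j') ^ 2 ∨
      4 * h ^ 2 ≤ dist (barlowPos a h s k i j) (barlowPos a h s k' i' j') ^ 2) := by
  rcases site_cases (a := a) (h := h) hs k i j k' i' j' with
    h0 | ⟨rfl, hm⟩ | ⟨rfl, hm⟩ | ⟨rfl, hm⟩ | hbig
  · exact absurd h0 hne
  · exact Or.inl (dist_sq_of_mem_sixOffsets hm)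
  · exact Or.inr (Or.inl (dist_sq_of_mem_threeOffsets_succ hs hm))
  · exact Or.inr (Or.inl (dist_sq_of_mem_threeOffsets_pred hs hm))
  · exact Or.inr (Or.inr hbig)

/-- The same for two distinct points of the stacking given as members of the point set.
[folklore] -/
theorem dist_sq_cases_of_mem (hs : IsHaggSeq s) {p q : EuclideanSpace ℝ (Fin 3)}
    (hp : p ∈ barlowStacking a h s) (hq : q ∈ barlowStacking a h s) (hpq : p ≠ q) :
    dist p q ^ 2 = a ^ 2 ∨ dist p q ^ 2 = a ^ 2 / 3 + h ^ 2 ∨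
    (3 * a ^ 2 ≤ dist p q ^ 2 ∨ 4 * a ^ 2 / 3 + h ^ 2 ≤ dist p q ^ 2 ∨ 4 * h ^ 2 ≤ dist p q ^ 2) := by
  obtain ⟨k, i, j, rfl⟩ := hp
  obtain ⟨k', i', j', rfl⟩ := hq
  refine dist_sq_cases hs ?_
  rintro heq
  simp only [Prod.mk.injEq] at heq
  obtain ⟨rfl, rfl, rfl⟩ := heq
  exact hpq rfl

/-! ## The first shell as a set, and its cardinality -/

/-- **The punctured `ρ`-ball about a site is the first shell** when `max a a' ≤ ρ` and `ρ²` is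
below the three second-shell bounds `3a²`, `4a²/3 + h²`, `4h²` (`a > 0`). [folklore] -/
theorem shell_eq_union (hs : IsHaggSeq s) (ha : 0 < a) {ρ : ℝ} (hρa : a ≤ ρ)
    (hρa' : √(a ^ 2 / 3 + h ^ 2) ≤ ρ) (hρ1 : ρ ^ 2 < 3 * a ^ 2) (hρ2 : ρ ^ 2 < 4 * a ^ 2 / 3 + h ^ 2)
    (hρ3 : ρ ^ 2 < 4 * h ^ 2) (k i j : ℤ) :
    {w | w ∈ barlowStacking a h s ∧ w ≠ barlowPos a h s k i j ∧
        dist (barlowPos a h s k i j) w ≤ ρ} =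
      offsetPos a h s i j k '' ↑sixOffsets ∪
        (offsetPos a h s i j (k + 1) '' ↑(threeOffsets (-s k)) ∪
          offsetPos a h s i j (k - 1) '' ↑(threeOffsets (s (k - 1)))) := by
  have hρ0 : 0 ≤ ρ := ha.le.trans hρa
  have ha'sq : √(a ^ 2 / 3 + h ^ 2) ^ 2 = a ^ 2 / 3 + h ^ 2 := Real.sq_sqrt (by positivity)
  -- a member of the shell is in the ball and is not the centre
  have key : ∀ k' i' j' : ℤ, (dist (barlowPos a h s k i j) (barlowPos a h s k' i' j') ^ 2 = a ^ 2 ∨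
      dist (barlowPos a h s k i j) (barlowPos a h s k' i' j') ^ 2 = a ^ 2 / 3 + h ^ 2) →
      barlowPos a h s k' i' j' ≠ barlowPos a h s k i j ∧
        dist (barlowPos a h s k i j) (barlowPos a h s k' i' j') ≤ ρ := by
    intro k' i' j' hd
    have hpos : 0 < dist (barlowPos a h s k i j) (barlowPos a h s k' i' j') ^ 2 := by
      rcases hd with hd | hd <;> rw [hd] <;> positivity
    refine ⟨fun heq => ?_, ?_⟩
    · rw [heq, dist_self] at hpos
      norm_num at hpos
    · refine (pow_le_pow_iff_left₀ dist_nonneg hρ0 two_ne_zero).1 ?_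
      rcases hd with hd | hd
      · rw [hd]; exact pow_le_pow_left₀ ha.le hρa 2
      · rw [hd, ← ha'sq]; exact pow_le_pow_left₀ (Real.sqrt_nonneg _) hρa' 2
  ext w
  simp only [mem_setOf_eq, mem_union, mem_image, Finset.mem_coe]
  constructor
  · rintro ⟨⟨k', i', j', rfl⟩, hne, hd⟩
    have hd2 : dist (barlowPos a h s k i j) (barlowPos a h s k' i' j') ^ 2 ≤ ρ ^ 2 :=
      pow_le_pow_left₀ dist_nonneg hd 2
    rcases site_cases (a := a) (h := h) hs k i j k' i' j' with
      h0 | ⟨rfl, hm⟩ | ⟨rfl, hm⟩ | ⟨rfl, hm⟩ | hbig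
    · exfalso
      simp only [Prod.mk.injEq] at h0
      obtain ⟨rfl, rfl, rfl⟩ := h0
      exact hne rfl
    · exact Or.inl ⟨(i - i', j - j'), hm, by simp [offsetPos]⟩
    · exact Or.inr (Or.inl ⟨(i - i', j - j'), hm, by simp [offsetPos]⟩)
    · exact Or.inr (Or.inr ⟨(i - i', j - j'), hm, by simp [offsetPos]⟩)
    · exfalso
      rcases hbig with hb | hb | hb <;> linarith
  · rintro (⟨PQ, hm, rfl⟩ | ⟨PQ, hm, rfl⟩ | ⟨PQ, hm, rfl⟩)
    · refine ⟨barlowPos_mem _ _ _, key _ _ _ (Or.inl (dist_sq_of_mem_sixOffsets ?_))⟩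
      simpa using hm
    · refine ⟨barlowPos_mem _ _ _, key _ _ _ (Or.inr (dist_sq_of_mem_threeOffsets_succ hs ?_))⟩
      simpa using hm
    · refine ⟨barlowPos_mem _ _ _, key _ _ _ (Or.inr (dist_sq_of_mem_threeOffsets_pred hs ?_))⟩
      simpa using hm

/-- The union of the twelve offset images has exactly twelve elements (`a > 0`, `h ≠ 0`).
[folklore] -/
theorem ncard_union_offsets (ha : 0 < a) (hh : h ≠ 0) (k i j : ℤ) :
    (offsetPos a h s i j k '' ↑sixOffsets ∪
        (offsetPos a h s i j (k + 1) '' ↑(threeOffsets (-s k)) ∪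
          offsetPos a h s i j (k - 1) '' ↑(threeOffsets (s (k - 1))))).ncard = 12 := by
  have hinj := fun k' => offsetPos_injective (h := h) (s := s) ha i j k'
  have hlay : ∀ {k₁ k₂ : ℤ} (A B : Finset (ℤ × ℤ)), k₁ ≠ k₂ →
      Disjoint (offsetPos a h s i j k₁ '' ↑A) (offsetPos a h s i j k₂ '' ↑B) := by
    intro k₁ k₂ A B hk
    refine Set.disjoint_left.2 ?_
    rintro _ ⟨PQ, _, rfl⟩ ⟨PQ', _, heq⟩
    exact hk (offsetPos_layer_eq hh heq.symm)
  have hfin : ∀ (k' : ℤ) (A : Finset (ℤ × ℤ)), (offsetPos a h s i j k' '' ↑A).Finite :=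
    fun k' A => A.finite_toSet.image _
  rw [Set.ncard_union_eq ((hlay _ _ (by omega)).union_right (hlay _ _ (by omega))) (hfin _ _)
      ((hfin _ _).union (hfin _ _)),
    Set.ncard_union_eq (hlay _ _ (by omega)) (hfin _ _) (hfin _ _),
    Set.ncard_image_of_injective _ (hinj _), Set.ncard_image_of_injective _ (hinj _),
    Set.ncard_image_of_injective _ (hinj _), Set.ncard_coe_finset, Set.ncard_coe_finset,
    Set.ncard_coe_finset, card_sixOffsets, card_threeOffsets, card_threeOffsets]

/-- **Twelve first-shell neighbours** of every site of a relaxed Barlow stacking: for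
`max a a' ≤ ρ` below the second-shell bounds, exactly twelve points of the stacking other than
the site lie within `ρ` of it (`a > 0`, `h ≠ 0`). [folklore] -/
theorem ncard_shell (hs : IsHaggSeq s) (ha : 0 < a) (hh : h ≠ 0) {ρ : ℝ} (hρa : a ≤ ρ)
    (hρa' : √(a ^ 2 / 3 + h ^ 2) ≤ ρ) (hρ1 : ρ ^ 2 < 3 * a ^ 2) (hρ2 : ρ ^ 2 < 4 * a ^ 2 / 3 + h ^ 2)
    (hρ3 : ρ ^ 2 < 4 * h ^ 2) {p : EuclideanSpace ℝ (Fin 3)} (hp : p ∈ barlowStacking a h s) :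
    {w | w ∈ barlowStacking a h s ∧ w ≠ p ∧ dist p w ≤ ρ}.ncard = 12 := by
  obtain ⟨k, i, j, rfl⟩ := hp
  rw [shell_eq_union hs ha hρa hρa' hρ1 hρ2 hρ3, ncard_union_offsets ha hh]

/-- Beyond the first shell: a point of the stacking other than `p` and farther than `ρ` (with
`ρ` as in `ncard_shell`) is at squared distance at least `min` of the second-shell bounds; here in
the weak form "at least one of them". [folklore] -/
theorem second_shell_le_of_lt_dist (hs : IsHaggSeq s) {ρ : ℝ} (hρa : a ≤ ρ)
    (hρa' : √(a ^ 2 / 3 + h ^ 2) ≤ ρ) (ha : 0 < a) {p w : EuclideanSpace ℝ (Fin 3)}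
    (hp : p ∈ barlowStacking a h s) (hw : w ∈ barlowStacking a h s) (hρw : ρ < dist p w) :
    3 * a ^ 2 ≤ dist p w ^ 2 ∨ 4 * a ^ 2 / 3 + h ^ 2 ≤ dist p w ^ 2 ∨ 4 * h ^ 2 ≤ dist p w ^ 2 := by
  have hρ0 : 0 ≤ ρ := ha.le.trans hρa
  have hpw : p ≠ w := by
    rintro rfl
    rw [dist_self] at hρw
    linarith
  have hρ2 : ρ ^ 2 < dist p w ^ 2 := by
    exact pow_lt_pow_left₀ hρw hρ0 two_ne_zero
  rcases dist_sq_cases_of_mem hs hp hw hpw with hd | hd | hbig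
  · exfalso
    have : a ^ 2 ≤ ρ ^ 2 := pow_le_pow_left₀ ha.le hρa 2
    linarith
  · exfalso
    have ha'sq : √(a ^ 2 / 3 + h ^ 2) ^ 2 = a ^ 2 / 3 + h ^ 2 := Real.sq_sqrt (by positivity)
    have : a ^ 2 / 3 + h ^ 2 ≤ ρ ^ 2 := by
      rw [← ha'sq]; exact pow_le_pow_left₀ (Real.sqrt_nonneg _) hρa' 2
    linarith
  · exact hbig

/-! ## Energy per particle of the hcp periodic configuration on short-range radial functions -/

/-- **A pair function vanishing on all realised distances has energy per particle `0`** (for the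
hcp periodic configuration of the tree; in fact for any periodic configuration). [folklore] -/
theorem energyPerParticle_eq_zero_of (P : PeriodicConfiguration 3) (W : ℝ → ℝ)
    (hW : ∀ p ∈ P.points, ∀ q ∈ P.points, p ≠ q → W (dist p q) = 0) :
    P.energyPerParticle W = 0 := by
  unfold PeriodicConfiguration.energyPerParticle
  have : ∀ x ∈ P.motif,
      ∑' y : {y : EuclideanSpace ℝ (Fin 3) // y ∈ P.points ∧ y ≠ x}, W (dist x y.1) = 0 := by
    intro x hx
    have hx' : x ∈ P.points := P.mem_points_of_mem_motif hx
    have h0 : ∀ y : {y : EuclideanSpace ℝ (Fin 3) // y ∈ P.points ∧ y ≠ x}, W (dist x y.1) = 0 :=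
      fun y => hW x hx' y.1 y.2.1 (Ne.symm y.2.2)
    simp [h0]
  rw [Finset.sum_eq_zero this, mul_zero]

/-- **A pair function equal to `1` on the first shell and `0` beyond `ρ` has hcp energy per
particle `6`**: every site of `hcpStacking a h` has exactly twelve other sites within `ρ`
(`ncard_shell`), for `max a a' ≤ ρ` with `ρ²` below `3a²`, `4a²/3 + h²`, `4h²`. [folklore] -/
theorem energyPerParticle_hcp_eq_six_of (ha : a ≠ 0) (hh : h ≠ 0) (ha0 : 0 < a) {ρ : ℝ}
    (hρa : a ≤ ρ) (hρa' : √(a ^ 2 / 3 + h ^ 2) ≤ ρ) (hρ1 : ρ ^ 2 < 3 * a ^ 2)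
    (hρ2 : ρ ^ 2 < 4 * a ^ 2 / 3 + h ^ 2) (hρ3 : ρ ^ 2 < 4 * h ^ 2) (W : ℝ → ℝ)
    (hW1 : ∀ p ∈ hcpStacking a h, ∀ q ∈ hcpStacking a h, p ≠ q → dist p q ≤ ρ → W (dist p q) = 1)
    (hW0 : ∀ p ∈ hcpStacking a h, ∀ q ∈ hcpStacking a h, ρ < dist p q → W (dist p q) = 0) :
    (hcpPeriodicConfiguration ha hh).energyPerParticle W = 6 := by
  classical
  set P := hcpPeriodicConfiguration ha hh with hP
  have hpts : P.points = hcpStacking a h := hcpPeriodicConfiguration_points ha hh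
  have inner : ∀ x ∈ P.motif,
      ∑' y : {y : EuclideanSpace ℝ (Fin 3) // y ∈ P.points ∧ y ≠ x}, W (dist x y.1) = 12 := by
    intro x hx
    have hxS : x ∈ hcpStacking a h := hpts ▸ P.mem_points_of_mem_motif hx
    set U : Set (EuclideanSpace ℝ (Fin 3)) :=
      {w | w ∈ hcpStacking a h ∧ w ≠ x ∧ dist x w ≤ ρ} with hU
    have hUcard : U.ncard = 12 := ncard_shell isHaggSeq_alternating ha0 hh hρa hρa' hρ1 hρ2 hρ3 hxS
    have hUfin : U.Finite := Set.finite_of_ncard_ne_zero (by rw [hUcard]; norm_num)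
    change ∑' y : ({y | y ∈ P.points ∧ y ≠ x} : Set (EuclideanSpace ℝ (Fin 3))),
      W (dist x y) = 12
    rw [tsum_subtype (s := {y | y ∈ P.points ∧ y ≠ x}) (f := fun y => W (dist x y)),
      tsum_eq_sum (s := hUfin.toFinset) (L := SummationFilter.unconditional _) ?_]
    · have h1 : ∀ y ∈ hUfin.toFinset,
          Set.indicator {y | y ∈ P.points ∧ y ≠ x} (fun y => W (dist x y)) y = 1 := by
        intro y hy
        rw [Set.Finite.mem_toFinset] at hy
        obtain ⟨hyS, hyx, hyρ⟩ := hy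
        rw [Set.indicator_of_mem (show y ∈ {y | y ∈ P.points ∧ y ≠ x} from ⟨hpts ▸ hyS, hyx⟩)]
        exact hW1 x hxS y hyS (Ne.symm hyx) hyρ
      rw [Finset.sum_congr rfl h1, Finset.sum_const, nsmul_eq_mul, mul_one,
        ← Set.ncard_eq_toFinset_card U hUfin, hUcard]
      norm_num
    · intro y hy
      rw [Set.Finite.mem_toFinset] at hy
      by_cases hyT : y ∈ {y | y ∈ P.points ∧ y ≠ x}
      · rw [Set.indicator_of_mem hyT]
        have hyS : y ∈ hcpStacking a h := hpts ▸ hyT.1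
        have hρy : ρ < dist x y := by
          by_contra hle
          exact hy ⟨hyS, hyT.2, not_lt.1 hle⟩
        exact hW0 x hxS y hyS hρy
      · exact Set.indicator_of_notMem hyT _
  unfold PeriodicConfiguration.energyPerParticle
  rw [Finset.sum_congr rfl inner, Finset.sum_const, nsmul_eq_mul]
  have hm : (P.motif.card : ℝ) ≠ 0 := by
    exact_mod_cast (Finset.card_pos.2 P.motif_nonempty).ne'
  field_simp
  ring

end Summit.AtomisticToContinuum.Crystallization.Theorems.EnergyDerivativeOrderLimitTransfer

end
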